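import Summits.BirchSwinnertonDyer.Rank1Residual.Additive.X4ThreeResCertRecords4
import HarnessLib

/-!
# The kernel minimality of `14400o1` (x11c's Kraus pattern F2c) — the last binder of
# `Additive/X4ThreeResCertRecords4.lean` discharged: all 35 window RES-CERT rows of X4♯(3) have
# every non-`L`-data binder decided by the kernel
# (cell `b2b-bsdres`, seat additive-p4 gen 15, line V25 addendum)

HONEST FRAMING (cell `b2b-bsdres`, run/shared/lean/b2b/bsd-rank1-residual/, verbatim in every
file): the goal of the cell is to DELETE the COMBINATION-SHAPED residual classes of the
Birch–Swinnerton-Dyer formula for ALL analytic-rank `≤ 1` elliptic curves over `ℚ` — "full BSD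
formula for every rank `≤ 1` curve in class `C`" assembled STRICTLY from published theorems — so
that the rank-`≤ 1` remainder becomes exactly the CONSTRUCTION-SHAPED classes, which are TYPED
(missing-input `Prop`s), NOT attempted. This is not "finishing BSD". PER-PAIR record; the label X4
is UNCHANGED; nothing is booked. Theorems only (no definition, no named fact).

## What this file proves

Gen 15's record `X4ThreeResCert.bsdp3_v14400o1` (p247761) kept the global minimality of Cremona's
model `14400o1 = [0, 0, 0, −6000, 180000]` as a binder `hmin`: at `2` that model has `ord₂ c₄ = 8`,
`ord₂ c₆ = 10`, `ord₂ Δ = 14`, where Silverman's test and the Kraus patterns F2a/F2b/F3 of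
`X11RankOne.isGloballyMinimal_of_krausCriterion_bounded` are silent. The x11c seat had ALREADY met
this shape (`25920a1`, `92480b1`) and landed pattern **F2c** — `c₆ = 2¹⁰·M`, `M` odd, `ord₂ Δ < 24`
⟹ minimal at `2` (`X11b.isMinimalAt_two_of_c₆_eq_1024_mul`, Kraus 1989 Prop. 2) — with the
extended criterion `X11b.isGloballyMinimal_of_krausCriterion_bounded₂` (`X11b/ChaPairsMinimality.lean`).
Here `c₆(14400o1) = −155520000 = 2¹⁰·(−151875)`, so:

* `isGloballyMinimal_v14400o1` — Cremona's model of `14400o1` is globally minimal, decided by the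
  kernel (`decide` on the bounded₂ criterion);
* **`X4ThreeResCert.bsdp3_v14400o1_kernel`** — the record WITHOUT `hmin` (same statement otherwise),
  by instantiating `bsdp3_v14400o1` with the kernel instance. With it, ALL 35 window RES-CERT rows of
  census V21 have `Δ ≠ 0`, global minimality, `Addv`, surj(3) and the `3`-adic tower decided by the
  kernel; the binders left are Cremona's `L`-data (`r_an = 0`, `3 ∤ #Ш_an`, `3 ∤ ∏ c_ℓ`) and the
  optimality of the curve.

References: A. Kraus, Acta Arith. 54 (1989) Prop. 2 [Kraus1989]; J. H. Silverman, *AEC* (2009)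
VII.1 Remark 1.1 [SilvermanAEC2009]; the record's references as in `X4ThreeResCertRecords4.lean`.
-/

set_option autoImplicit false

noncomputable section

open scoped Classical

open WeierstrassCurve Literature.NumberTheory.EllipticCurves
  Literature.NumberTheory.EllipticCurves.ModularForms
  Literature.NumberTheory.EllipticCurves.Rank1Residual
  Literature.NumberTheory.EllipticCurves.Rank1Residual.Typed
  Literature.NumberTheory.EllipticCurves.AgasheRibetStein2006
  Literature.NumberTheory.EllipticCurves.Rank1Residual.X11RankOneCertificates

namespace Summit.BirchSwinnertonDyer.Rank1Residual.Additive

/-- **Cremona's model `14400o1 = [0, 0, 0, −6000, 180000]` is globally minimal**, decided by the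
kernel through x11c's bounded criterion with pattern F2c at `2` (`c₆ = 2¹⁰·(−151875)`,
`ord₂ Δ = 14 < 24`) and Silverman's test at the odd primes. [cite: Kraus1989, Prop. 2]
[cite: SilvermanAEC2009, VII.1 Remark 1.1] -/
theorem isGloballyMinimal_v14400o1 :
    (⟨0, 0, 0, -6000, 180000⟩ : WeierstrassCurve ℚ).IsGloballyMinimal :=
  X11b.isGloballyMinimal_of_krausCriterion_bounded₂ 0 0 0 (-6000) 180000
    (by decide +kernel) (by decide +kernel) (by decide +kernel)

/-- **`BSD(E,3)` for `14400o1` with NO minimality binder** (`N = 14400 = 2^6·3^2·5^2`; Cremona's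
minimal model `[0, 0, 0, -6000, 180000]`; ADDITIVE at `3`, Kodaira `III`, potentially good;
`ρ̄_{E,3}` onto and `ρ̄_{E,3^n}` onto for all `n` IN THE KERNEL — lit-kato GEN 6 `surj3_v14400o1`,
`towerSurj3_v14400o1`; global minimality IN THE KERNEL — `isGloballyMinimal_v14400o1`). Per-pair
binders (Cremona `allbsd`; hyp tables): `r_an = 0`, `#Ш_an = 1`, `∏ c_ℓ = 2` (`3 ∤ ∏ c_ℓ`), `14400o1`
optimal at level `14400`. Supersedes `bsdp3_v14400o1` (same statement minus `hmin`).
[cite: Kato2004Asterisque, Thm. 14.5 (3) (p. 236) and (12.5.2) (p. 222)]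
[cite: AgasheRibetStein2006, Thm. 2.6 (p. 619) and appendix Thm. 5.2 (p. 633)]
[cite: Kraus1989, Prop. 2] [cite: Miller2011LMS, §1 and Def. 1.1] -/
theorem X4ThreeResCert.bsdp3_v14400o1_kernel
    (hKatoS : Kato2004.rankZero_padicValNat_sha_le_sub_localTamagawa_of_additive_potGood_of_imageContainsSL2)
    (hDel : Delbourgo1998.prop4_rankZero_pow_dvd_constantCoeff)
    (hGZK : rank_eq_analyticRank_of_analyticRank_le_one) (hmod : hasEntireLFunction_rat)
    (hmodD : nonempty_modularParametrizationData)
    (hL20 : Wuthrich2014.lemma20_surjective_threeAdic_of_semistable)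
    (hKatoχ : Wuthrich2014.kato_halfEigenCharIdeal_dvd_cyclotomicPrime_of_surjective)
    (h26 : cremona_abs_maninConstant_eq_one_of_level_le)
    (W : WeierstrassCurve ℚ) (hW : W = ⟨0, 0, 0, -6000, 180000⟩)
    (hr : W.analyticRank = 0) {q : ℚ} (hq : shaAn W = (q : ℂ)) (hv : padicValRat 3 q = 0)
    (htam : ¬ 3 ∣ W.tamagawaProduct)
    (hopt : ∃ D : ModularParametrizationData W 14400,
      ∀ z ∈ D.L.lattice, ∃ w ∈ periodLattice D.f, z = D.c * w) :
    haveI : Fact (Nat.Prime 3) := ⟨Nat.prime_three⟩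
    BSDp W 3 := by
  subst hW
  haveI := isGloballyMinimal_v14400o1
  exact X4ThreeResCert.bsdp3_v14400o1 hKatoS hDel hGZK hmod hmodD hL20 hKatoχ h26 _ rfl hr hq hv htam
    hopt

end Summit.BirchSwinnertonDyer.Rank1Residual.Additive

end
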